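import Summits.QuantumFields.YangMills.Theorems.LuscherReductionTwistedTraceScalingBOStiffFlatDefs
import Summits.QuantumFields.YangMills.Theorems.LuscherReductionTwistedTraceScalingBOStiffCentralLower
import Summits.QuantumFields.YangMills.Theorems.LuscherReductionTwistedTraceScalingBOStiffCoreMass
import Summits.QuantumFields.YangMills.Theorems.LuscherReductionTwistedTraceScalingBTProfileAssembly
import Summits.QuantumFields.YangMills.Theorems.LuscherReductionRunningReductionLatticeTopLower
import Summits.QuantumFields.YangMills.Theorems.LuscherReductionTwistedTraceScalingSlowShadow
import HarnessLib

/-!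
# (B-ST) atom (B4): data of the MODEL JUMP `cK` and the floor of the profile-weighted jump mass `cIk`
# (lane A of S-BASE, crux `TwistedTraceScaling` stmt-QuantumFields-20203, C4-CORE, the (B-ST) pen; `pub/ym-fleet/ym-luscher-20007-p1/HANDOFF-g22.md` §DESIGN 4)

Bookkeeping for the jump floor `hJ` (next file `…BOStiffJumpFloor`) on the objects of ✓`…BOStiffFlatDefs`:
* §1 `cK` is symmetric, jointly measurable, `0 < cK ≤ 1`; `0 < cA`; the Wilson action at a central tube point of the profile support `S(orthoTube 1 x) ≤ 64|P|‖x̂‖²`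
  (✓`wilsonAction_le_of_near_one`), hence ★ `cK_floor`: `e^{−(64|P|+4)·β·r(β)²} ≤ cK` on `cS × cS` (`r(β) = min(1/40, β^{-1/2}ℓ)`);
* §2 integration bookkeeping on `π ⊗ π` (`iter_integral_lin`, `iter_integral_cΘ_sq`, `cΘ_data`);
* §3 `0 < ∫cΘ dπ` (✓`integral_profile_pos`), ★ `cIk_ge`: `e^{−(64|P|+4)βr²}·(∫cΘ dπ)² ≤ cIk`, `cIk_pos`.
HONEST FRAMING: bookkeeping for a stub of a child of the CONDITIONAL route R2b1; (B-ST) OPEN; C4-CORE OPEN; not infinite volume, not a gap, not Clay.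
-/

set_option autoImplicit false

noncomputable section

open MeasureTheory Filter Topology Real
open scoped BigOperators
open Literature.MathematicalPhysics.QuantumFieldTheory
open Literature.MathematicalPhysics.QuantumLattice

namespace Summit.QuantumFields.YangMills.Theorems.FemtoTransferGap.TwoLattice.ConstTube

open Summit.QuantumFields.YangMills.Theorems.FemtoTransferGap
open Summit.QuantumFields.YangMills.Theorems.FemtoTransferGap.TwoLattice
open Summit.QuantumFields.YangMills.Theorems.FemtoTransferGap.TwoLattice.Avg
open Summit.QuantumFields.YangMills.Theorems.FemtoTransferGap.TwoLattice.Stiff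
open Summit.QuantumFields.YangMills.Theorems.FemtoTransferGap.TwoLattice.GnChart
open Summit.QuantumFields.YangMills.Theorems.FemtoTransferGap.TwoLattice.Cov (scalarPart_inv vecPart_inv)

variable {L : ℕ} [NeZero L]

/-! ## §1 Data of the model jump -/

/-- `cK` is symmetric. [folklore] -/
theorem cK_symm (β : ℝ) (x y : Edge 3 L → Fin 3 → ℝ) : cK L β x y = cK L β y x := by
  unfold cK
  have h : ‖linkEmbed L (y - x) - (gaugeModes L).starProjection (linkEmbed L (y - x))‖ =
      ‖linkEmbed L (x - y) - (gaugeModes L).starProjection (linkEmbed L (x - y))‖ := by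
    rw [show y - x = -(x - y) by abel, map_neg, map_neg, ← neg_sub', norm_neg]
  rw [h, add_comm (wilsonAction su2Rep (orthoTube L 1 y))]

/-- `0 < cK ≤ 1`. [folklore] -/
theorem cK_pos_le_one {β : ℝ} (hβ : 0 ≤ β) (x y : Edge 3 L → Fin 3 → ℝ) : 0 < cK L β x y ∧ cK L β x y ≤ 1 := by
  unfold cK
  refine ⟨mul_pos (Real.exp_pos _) (Real.exp_pos _), ?_⟩
  have h1 : Real.exp (-(β / 2 * (wilsonAction su2Rep (orthoTube L 1 x) + wilsonAction su2Rep (orthoTube L 1 y)))) ≤ 1 :=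
    Real.exp_le_one_iff.2 (by have := wilsonAction_su2_nonneg_lat (orthoTube L 1 x); have := wilsonAction_su2_nonneg_lat (orthoTube L 1 y); nlinarith)
  have h2 : Real.exp (-(β * ‖linkEmbed L (x - y) - (gaugeModes L).starProjection (linkEmbed L (x - y))‖ ^ 2)) ≤ 1 :=
    Real.exp_le_one_iff.2 (by nlinarith [sq_nonneg ‖linkEmbed L (x - y) - (gaugeModes L).starProjection (linkEmbed L (x - y))‖])
  exact mul_le_one₀ h1 (Real.exp_pos _).le h2

/-- `cK` is jointly measurable. [folklore] -/
theorem measurable_cK (β : ℝ) : Measurable (Function.uncurry (cK L β)) := by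
  have hS0 : Measurable fun U : GaugeConfig 3 L SU2 => wilsonAction su2Rep U := (continuous_wilsonAction su2Rep continuous_su2Rep).measurable
  have hS : Measurable fun x : Edge 3 L → Fin 3 → ℝ => wilsonAction su2Rep (orthoTube L 1 x) := hS0.comp (measurable_orthoTube_right (L := L) 1)
  have hN : Measurable fun p : (Edge 3 L → Fin 3 → ℝ) × (Edge 3 L → Fin 3 → ℝ) =>
      ‖linkEmbed L (p.1 - p.2) - (gaugeModes L).starProjection (linkEmbed L (p.1 - p.2))‖ := by
    have hl : Continuous fun p : (Edge 3 L → Fin 3 → ℝ) × (Edge 3 L → Fin 3 → ℝ) => linkEmbed L (p.1 - p.2) :=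
      (linkEmbed L).continuous_of_finiteDimensional.comp (continuous_fst.sub continuous_snd)
    exact (hl.sub ((gaugeModes L).starProjection.continuous.comp hl)).norm.measurable
  have h : Measurable fun p : (Edge 3 L → Fin 3 → ℝ) × (Edge 3 L → Fin 3 → ℝ) =>
      Real.exp (-(β / 2 * (wilsonAction su2Rep (orthoTube L 1 p.1) + wilsonAction su2Rep (orthoTube L 1 p.2)))) *
        Real.exp (-(β * ‖linkEmbed L (p.1 - p.2) - (gaugeModes L).starProjection (linkEmbed L (p.1 - p.2))‖ ^ 2)) :=
    ((((hS.comp measurable_fst).add (hS.comp measurable_snd)).const_mul (β / 2)).neg.exp).mul (((hN.pow_const 2).const_mul β).neg.exp)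
  exact h

/-- `0 < cA`. [folklore] -/
theorem cA_pos (β : ℝ) : 0 < cA L β := by
  unfold cA; exact mul_pos (pow_pos (Real.exp_pos _) _) (fpWeightBar_pos L (powScale_pos _ _))

/-- The Wilson action at a central tube point of the profile support: `S(orthoTube 1 x) ≤ 64|P|·‖x̂‖²`. [folklore] -/
theorem wilsonAction_orthoTube_one_le_sq {β : ℝ} {x : Edge 3 L → Fin 3 → ℝ} (hx : x ∈ cS L β) :
    wilsonAction su2Rep (orthoTube L 1 x) ≤ 64 * Fintype.card (Plaquette 3 L) * ‖linkEmbed L x‖ ^ 2 := by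
  have hx1 : ∀ e, ∑ a, x e a ^ 2 ≤ 1 := sum_sq_le_one_of_mem_cS hx
  have hF : ∀ e, frobNorm (((orthoTube L 1 x e : SU2) : Matrix (Fin 2) (Fin 2) ℂ) - 1) ≤ 2 * Real.sqrt 2 * ‖linkEmbed L x‖ := fun e =>
    (frobNorm_sub_one_le_two_norm _).trans (by have := norm_su2Quat_orthoTube_one_sub_one_le hx1 e; linarith)
  have h := wilsonAction_le_of_near_one (orthoTube L 1 x) hF
  have h2 : (2 * Real.sqrt 2 * ‖linkEmbed L x‖) ^ 2 = 8 * ‖linkEmbed L x‖ ^ 2 := by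
    rw [mul_pow, mul_pow, Real.sq_sqrt (by norm_num)]; ring
  rw [h2] at h; linarith

/-- ★ **Floor of the model jump on `cS × cS`**: `exp(−(64|P|+4)·β·r(β)²) ≤ cK β x y` (`β ≥ 0`, `r(β) = min(1/40, β^{-1/2}ℓ)`). [folklore] -/
theorem cK_floor {β : ℝ} (hβ : 0 ≤ β) {x y : Edge 3 L → Fin 3 → ℝ} (hx : x ∈ cS L β) (hy : y ∈ cS L β) :
    Real.exp (-((64 * Fintype.card (Plaquette 3 L) + 4) * β * (min (1 / 40) (powScale (1 / 2) β * btLog β)) ^ 2)) ≤ cK L β x y := by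
  set r := min (1 / 40) (powScale (1 / 2) β * btLog β) with hr
  obtain ⟨-, hxr⟩ := cΘ_eq_on_cS (L := L) β hx
  obtain ⟨-, hyr⟩ := cΘ_eq_on_cS (L := L) β hy
  change ‖linkEmbed L x‖ ≤ r at hxr
  change ‖linkEmbed L y‖ ≤ r at hyr
  have hr0 : 0 ≤ r := (norm_nonneg _).trans hxr
  have hSx := wilsonAction_orthoTube_one_le_sq (L := L) hx
  have hSy := wilsonAction_orthoTube_one_le_sq (L := L) hy
  have hP0 : (0 : ℝ) ≤ Fintype.card (Plaquette 3 L) := by positivity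
  have hx2 : ‖linkEmbed L x‖ ^ 2 ≤ r ^ 2 := pow_le_pow_left₀ (norm_nonneg _) hxr 2
  have hy2 : ‖linkEmbed L y‖ ^ 2 ≤ r ^ 2 := pow_le_pow_left₀ (norm_nonneg _) hyr 2
  have hΔ : ‖linkEmbed L (x - y) - (gaugeModes L).starProjection (linkEmbed L (x - y))‖ ^ 2 ≤ 4 * r ^ 2 := by
    have h1 : ‖linkEmbed L (x - y) - (gaugeModes L).starProjection (linkEmbed L (x - y))‖ ≤ ‖linkEmbed L (x - y)‖ := by
      rw [← Submodule.starProjection_orthogonal_val]; exact Submodule.norm_starProjection_apply_le _ _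
    have h2 : ‖linkEmbed L (x - y)‖ ≤ 2 * r := by
      rw [map_sub]; exact (norm_sub_le _ _).trans (by linarith)
    have h3 := pow_le_pow_left₀ (norm_nonneg _) (h1.trans h2) 2
    nlinarith
  unfold cK
  rw [← Real.exp_add]
  refine Real.exp_le_exp.2 ?_
  have hsum : wilsonAction su2Rep (orthoTube L 1 x) + wilsonAction su2Rep (orthoTube L 1 y) ≤ 64 * Fintype.card (Plaquette 3 L) * (2 * r ^ 2) := by
    have := mul_le_mul_of_nonneg_left (add_le_add hx2 hy2) (by positivity : (0 : ℝ) ≤ 64 * Fintype.card (Plaquette 3 L))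
    linarith
  have hβ2 : 0 ≤ β / 2 := by linarith
  nlinarith [mul_le_mul_of_nonneg_left hsum hβ2, mul_le_mul_of_nonneg_left hΔ hβ]

/-! ## §2 Integration bookkeeping on `π ⊗ π` -/

/-- Linearity of bounded iterated integrals: `∫∫ (a·F + b·G) = a∫∫F + b∫∫G`. [folklore] -/
theorem iter_integral_lin {F G : (Edge 3 L → Fin 3 → ℝ) × (Edge 3 L → Fin 3 → ℝ) → ℝ} (hF : Measurable F) {CF : ℝ} (hCF : ∀ p, |F p| ≤ CF)
    (hG : Measurable G) {CG : ℝ} (hCG : ∀ p, |G p| ≤ CG) (a b : ℝ) :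
    ∫ x, ∫ y, (a * F (x, y) + b * G (x, y)) ∂orthoTransverse L ∂orthoTransverse L =
      a * ∫ x, ∫ y, F (x, y) ∂orthoTransverse L ∂orthoTransverse L + b * ∫ x, ∫ y, G (x, y) ∂orthoTransverse L ∂orthoTransverse L := by
  haveI := isFiniteMeasure_orthoTransverse L
  have hH : Measurable fun p : (Edge 3 L → Fin 3 → ℝ) × (Edge 3 L → Fin 3 → ℝ) => a * F p + b * G p := (hF.const_mul a).add (hG.const_mul b)
  have hHb : ∀ p, |a * F p + b * G p| ≤ |a| * CF + |b| * CG := fun p => by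
    calc |a * F p + b * G p| ≤ |a * F p| + |b * G p| := abs_add_le _ _
      _ = |a| * |F p| + |b| * |G p| := by rw [abs_mul, abs_mul]
      _ ≤ |a| * CF + |b| * CG := add_le_add (mul_le_mul_of_nonneg_left (hCF p) (abs_nonneg a)) (mul_le_mul_of_nonneg_left (hCG p) (abs_nonneg b))
  rw [iter_integral_eq_prod (μ := orthoTransverse L) (ν := orthoTransverse L) hH hHb, iter_integral_eq_prod (μ := orthoTransverse L) (ν := orthoTransverse L) hF hCF,
    iter_integral_eq_prod (μ := orthoTransverse L) (ν := orthoTransverse L) hG hCG]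
  have hFi := integrable_of_measurable_abs_le ((orthoTransverse L).prod (orthoTransverse L)) hF hCF
  have hGi := integrable_of_measurable_abs_le ((orthoTransverse L).prod (orthoTransverse L)) hG hCG
  rw [integral_add (hFi.const_mul a) (hGi.const_mul b), integral_const_mul, integral_const_mul]

/-- `∫∫ Θ(x)Θ(y) = (∫Θ)²`. [folklore] -/
theorem iter_integral_cΘ_sq (β : ℝ) : ∫ x, ∫ y, cΘ L β x * cΘ L β y ∂orthoTransverse L ∂orthoTransverse L = (∫ x, cΘ L β x ∂orthoTransverse L) ^ 2 := by
  have : ∀ x, ∫ y, cΘ L β x * cΘ L β y ∂orthoTransverse L = cΘ L β x * ∫ y, cΘ L β y ∂orthoTransverse L := fun x => integral_const_mul _ _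
  simp_rw [this]
  rw [integral_mul_const, sq]

/-- The profile data used below. [folklore] -/
theorem cΘ_data (β : ℝ) : Measurable (cΘ L β) ∧ (∀ x, |cΘ L β x| ≤ 1) ∧ (∀ x, 0 ≤ cΘ L β x) :=
  ⟨measurable_cΘ (L := L) β, fun x => (cΘ_mem_Icc (L := L) β x).2.2, fun x => (cΘ_mem_Icc (L := L) β x).1⟩

/-! ## §3 Positivity and the floor of the jump mass -/

/-- `0 < ∫ cΘ dπ` (the profile is `> 0` on a ball around `0`). [folklore] -/
theorem integral_cΘ_pos (β : ℝ) : 0 < ∫ x, cΘ L β x ∂orthoTransverse L := by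
  have hr : 0 < min (1 / 40 : ℝ) (powScale (1 / 2) β * btLog β) := lt_min (by norm_num) (mul_pos (powScale_pos _ _) (lt_of_lt_of_le one_pos (one_le_btLog β)))
  have hFm : Measurable (frozenProfile L (fun β' => stiffGaussExp L (β' / 2) β') (fun β' => min (1 / 40) (powScale (1 / 2) β' * btLog β')) β) :=
    measurable_frozenProfile (fun β' => measurable_stiffGaussExp _ _) _ β
  have hF1 : ∀ x, |frozenProfile L (fun β' => stiffGaussExp L (β' / 2) β') (fun β' => min (1 / 40) (powScale (1 / 2) β' * btLog β')) β x| ≤ 1 :=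
    fun x => abs_frozenProfile_le (fun β' x => stiffGaussExp_nonneg _ _ x) _ β x
  have hF0 : ∀ x, 0 ≤ frozenProfile L (fun β' => stiffGaussExp L (β' / 2) β') (fun β' => min (1 / 40) (powScale (1 / 2) β' * btLog β')) β x :=
    fun x => (frozenProfile_mem_Icc (fun β' x => stiffGaussExp_nonneg _ _ x) _ β x).1
  have h := integral_profile_pos (L := L) hFm hF1 hF0 hr (fun x hx => frozenProfile_ne_zero_of_norm_lt _ _ β hx)
  have e := integral_capRestrict_linkEmbed (L := L) (frozenProfile L (fun β' => stiffGaussExp L (β' / 2) β') (fun β' => min (1 / 40) (powScale (1 / 2) β' * btLog β')) β)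
  have e2 : ∫ x, cΘ L β x ∂orthoTransverse L = ∫ v, {x : LinkSpace L | linkCurry x ∈ capBalancedSet L}.indicator (fun _ => (1 : ℝ)) (linkEmbed L v) *
      frozenProfile L (fun β' => stiffGaussExp L (β' / 2) β') (fun β' => min (1 / 40) (powScale (1 / 2) β' * btLog β')) β (linkEmbed L v) ∂orthoTransverse L := rfl
  rw [e2, e]; exact h

/-- ★ **Floor of the jump mass**: `exp(−(64|P|+4)βr²)·(∫cΘ dπ)² ≤ cIk β` (`β ≥ 0`). [folklore] -/
theorem cIk_ge {β : ℝ} (hβ : 0 ≤ β) :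
    Real.exp (-((64 * Fintype.card (Plaquette 3 L) + 4) * β * (min (1 / 40) (powScale (1 / 2) β * btLog β)) ^ 2)) * (∫ x, cΘ L β x ∂orthoTransverse L) ^ 2 ≤ cIk L β := by
  haveI := isFiniteMeasure_orthoTransverse L
  set m := Real.exp (-((64 * Fintype.card (Plaquette 3 L) + 4) * β * (min (1 / 40) (powScale (1 / 2) β * btLog β)) ^ 2)) with hm
  have hm0 : 0 < m := Real.exp_pos _
  have hm1 : m ≤ 1 := Real.exp_le_one_iff.2 (by
    have : 0 ≤ (64 * (Fintype.card (Plaquette 3 L) : ℝ) + 4) * β * (min (1 / 40) (powScale (1 / 2) β * btLog β)) ^ 2 := by positivity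
    linarith)
  obtain ⟨hΘm, hΘ1, hΘ0⟩ := cΘ_data (L := L) β
  have hKm := measurable_cK (L := L) β
  have hK1 : ∀ x y, |cK L β x y| ≤ 1 := fun x y => by
    obtain ⟨h0, h1⟩ := cK_pos_le_one (L := L) hβ x y; rw [abs_of_pos h0]; exact h1
  -- pointwise
  have hpt : ∀ p : (Edge 3 L → Fin 3 → ℝ) × (Edge 3 L → Fin 3 → ℝ), m * (cΘ L β p.1 * cΘ L β p.2) ≤ cΘ L β p.1 * cK L β p.1 p.2 * cΘ L β p.2 := by
    rintro ⟨x, y⟩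
    by_cases hx : x ∈ cS L β
    · by_cases hy : y ∈ cS L β
      · have hk := cK_floor (L := L) hβ hx hy
        have := mul_le_mul_of_nonneg_left hk (mul_nonneg (hΘ0 x) (hΘ0 y))
        simp only; nlinarith [this]
      · simp only; rw [cΘ_eq_zero_of_not_mem_cS β y hy]; simp
    · simp only; rw [cΘ_eq_zero_of_not_mem_cS β x hx]; simp
  have hF : Measurable fun p : (Edge 3 L → Fin 3 → ℝ) × (Edge 3 L → Fin 3 → ℝ) => m * (cΘ L β p.1 * cΘ L β p.2) :=
    ((hΘm.comp measurable_fst).mul (hΘm.comp measurable_snd)).const_mul m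
  have hFb : ∀ p : (Edge 3 L → Fin 3 → ℝ) × (Edge 3 L → Fin 3 → ℝ), |m * (cΘ L β p.1 * cΘ L β p.2)| ≤ 1 := fun p => by
    rw [abs_mul, abs_mul, abs_of_pos hm0]
    have h12 : |cΘ L β p.1| * |cΘ L β p.2| ≤ 1 := mul_le_one₀ (hΘ1 _) (abs_nonneg _) (hΘ1 _)
    exact mul_le_one₀ hm1 (mul_nonneg (abs_nonneg _) (abs_nonneg _)) h12
  have hG : Measurable fun p : (Edge 3 L → Fin 3 → ℝ) × (Edge 3 L → Fin 3 → ℝ) => cΘ L β p.1 * cK L β p.1 p.2 * cΘ L β p.2 :=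
    ((hΘm.comp measurable_fst).mul hKm).mul (hΘm.comp measurable_snd)
  have hGb : ∀ p : (Edge 3 L → Fin 3 → ℝ) × (Edge 3 L → Fin 3 → ℝ), |cΘ L β p.1 * cK L β p.1 p.2 * cΘ L β p.2| ≤ 1 := fun p => by
    rw [abs_mul, abs_mul]
    exact mul_le_one₀ (mul_le_one₀ (hΘ1 _) (abs_nonneg _) (hK1 _ _)) (abs_nonneg _) (hΘ1 _)
  have h := iter_integral_mono (μ := orthoTransverse L) (ν := orthoTransverse L) hF hFb hG hGb hpt
  have e1 : ∫ x, ∫ y, m * (cΘ L β x * cΘ L β y) ∂orthoTransverse L ∂orthoTransverse L = m * (∫ x, cΘ L β x ∂orthoTransverse L) ^ 2 := by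
    rw [← iter_integral_cΘ_sq, ← integral_const_mul]; congr 1; funext x; rw [integral_const_mul]
  rw [e1] at h
  exact h

/-- ★ `0 < cIk β` (`β ≥ 0`). [folklore] -/
theorem cIk_pos {β : ℝ} (hβ : 0 ≤ β) : 0 < cIk L β :=
  lt_of_lt_of_le (mul_pos (Real.exp_pos _) (pow_pos (integral_cΘ_pos (L := L) β) 2)) (cIk_ge (L := L) hβ)


end Summit.QuantumFields.YangMills.Theorems.FemtoTransferGap.TwoLattice.ConstTube

end
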